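import Literature.Geometry.Riemannian.ABPJacobianComparison
import Mathlib.Analysis.SpecialFunctions.SmoothTransition
import Mathlib.Analysis.Calculus.BumpFunction.InnerProduct
import Literature.Analysis.Calculus.SmoothCutoff
import HarnessLib

/-!
# No conjugate points for the ABP map (Brendle 2023, Lemma 2.4), matrix form

Topic `Geometry/Riemannian`. The second brick of the matrix-ODE layer of S. Brendle's ABP proof of
the sharp Sobolev / isoperimetric inequality on complete manifolds with `Ric ≥ 0` (*Sobolev
inequalities in manifolds with nonnegative curvature*, CPAM 76 (2023), §2). Lemma 2.3 there says
that at a point `x̄` of the contact set `A_r`, along `γ̄(t) = exp_x̄(t∇u(x̄))`, every smooth vector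
field `Z` along `γ̄` with `Z(r) = 0` satisfies the **second-variation inequality**
`(D²u)(Z(0),Z(0)) + ∫₀ʳ (|D_tZ|² − R(γ̄',Z,γ̄',Z)) dt ≥ 0`; Lemma 2.4 deduces that a Jacobi field
`W` with `⟨D_tW(0), e_j⟩ = (D²u)(W(0), e_j)` vanishing at some `τ ∈ (0, r)` vanishes identically —
so the matrix `P(t)` of Prop. 2.5 is invertible on `(0, r)`, the hypothesis `hunit` of
`Literature.Geometry.Riemannian.antitoneOn_det_div_pow_of_hessian` (`ABPJacobianComparison.lean`).

We prove this in a parallel orthonormal frame, i.e. for matrix curves (column convention of the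
tree: `𝒜'' + ℛ𝒜 = 0`, `𝒜(0) = I`, `𝒜'(0) = ℋ` symmetric): **if the quadratic form
`Q(Z) = tr(Z(0)ᵀ ℋ Z(0)) + ∫₀ʳ (tr(Z'ᵀZ') − tr(Zᵀ ℛ Z)) dt` is `≥ 0` on smooth matrix curves `Z`
with `Z(r) = 0`, then `det 𝒜(t) ≠ 0` for `t ∈ [0, r)`** (`isUnit_det_jacobi_of_secondVariation`).
Brendle's printed proof minimises the index form over piecewise `C¹` fields and invokes the
regularity of minimisers; we replace this by an explicit perturbation: if `𝒜(τ)C₀ = 0`, `C₀ ≠ 0`,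
then `W = 𝒜C₀` has `W(0) = C₀`, `W(τ) = 0`, `V = W'(τ) ≠ 0` (backward uniqueness for the linear
ODE, by an energy/Grönwall argument), and for a cut-off `ψ_δ` (`= 1` before `τ − δ`, `= 0` after
`τ + δ`) and a bump `Y` at `τ` with `Y(τ) = V` one computes exactly
`Q(ψ_δ W + ηY) = ∫ ψ_δ'² tr(WᵀW) + 2η ∫ ψ_δ' (tr(WᵀY') − tr(W'ᵀY)) + η² I(Y,Y)`
(`secondVariation_integrand_identity` plus an exact derivative), which is
`≤ K₂δ + (3/2)η tr(VᵀV) + η² I(Y,Y) < 0` for small `η < 0` and then small `δ` — a contradiction.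

* Frobenius toolkit: `trace_transpose_mul_self_nonneg`, `trace_transpose_mul_self_eq_zero_iff`,
  `two_mul_abs_trace_transpose_mul_le`, `trace_transpose_mul_self_mul_le`;
* `jacobi_eq_zero_of_eq_zero` — **backward uniqueness**: `𝒜(τ)C₀ = 0 = 𝒜'(τ)C₀ ⇒ C₀ = 0`;
* `exists_smooth_cutoff_abs_deriv_le` — the cut-offs `ψ_δ` with `|ψ_δ'| ≤ M/δ` (slope bound from
  `Literature.Analysis.Calculus.exists_bound_deriv_smoothTransition`);
* `secondVariation_integrand_identity` — the pointwise algebra of `Q(ψW + ηY)`;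
* `isUnit_det_jacobi_of_secondVariation` — **Lemma 2.4** (main theorem).

Pure real analysis; no definitions, no named facts.

## References

* [Brendle2022] S. Brendle, CPAM 76 (2023) 2192–2218 (arXiv:2009.13717), §2, Lemmas 2.3–2.4
  (p. 5 of the arXiv text). READ.
-/

noncomputable section

namespace Literature.Geometry.Riemannian

section ABPNoConjugate

open Set Filter Topology Matrix MeasureTheory intervalIntegral

open scoped Matrix.Norms.Operator ContDiff

variable {ι : Type*} [Fintype ι] [DecidableEq ι]

/-! ### Frobenius toolkit: `tr(WᵀW) = Σ W_{ij}²` -/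

omit [DecidableEq ι] in
/-- `tr(Wᵀ W) = Σᵢⱼ Wᵢⱼ²`. [folklore] -/
theorem trace_transpose_mul_self_eq_sum (W : Matrix ι ι ℝ) :
    (Wᵀ * W).trace = ∑ i, ∑ j, W j i ^ 2 := by
  simp only [Matrix.trace, Matrix.diag, Matrix.mul_apply, Matrix.transpose_apply, sq]

omit [DecidableEq ι] in
/-- `tr(Wᵀ W) ≥ 0`. [folklore] -/
theorem trace_transpose_mul_self_nonneg (W : Matrix ι ι ℝ) : 0 ≤ (Wᵀ * W).trace := by
  rw [trace_transpose_mul_self_eq_sum]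
  positivity

omit [DecidableEq ι] in
/-- `tr(Wᵀ W) = 0 ↔ W = 0`. [folklore] -/
theorem trace_transpose_mul_self_eq_zero_iff (W : Matrix ι ι ℝ) : (Wᵀ * W).trace = 0 ↔ W = 0 := by
  constructor
  · intro h
    rw [trace_transpose_mul_self_eq_sum] at h
    ext i j
    have h1 : ∑ j', W j' j ^ 2 = 0 := by
      have := (Finset.sum_eq_zero_iff_of_nonneg (fun i _ ↦ Finset.sum_nonneg
        fun j _ ↦ sq_nonneg (W j i))).1 h j (Finset.mem_univ _)
      exact this
    have h2 := (Finset.sum_eq_zero_iff_of_nonneg (fun j' _ ↦ sq_nonneg (W j' j))).1 h1 i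
      (Finset.mem_univ _)
    simpa using h2
  · intro h; simp [h]

omit [DecidableEq ι] in
/-- Cauchy–Schwarz for the Frobenius pairing: `2|tr(WᵀY)| ≤ tr(WᵀW) + tr(YᵀY)`. [folklore] -/
theorem two_mul_abs_trace_transpose_mul_le (W Y : Matrix ι ι ℝ) :
    2 * |(Wᵀ * Y).trace| ≤ (Wᵀ * W).trace + (Yᵀ * Y).trace := by
  have hsum : (Wᵀ * Y).trace = ∑ i, ∑ j, W j i * Y j i := by
    simp only [Matrix.trace, Matrix.diag, Matrix.mul_apply, Matrix.transpose_apply]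
  rw [hsum, trace_transpose_mul_self_eq_sum, trace_transpose_mul_self_eq_sum]
  have hplus : 0 ≤ ∑ i, ∑ j, (W j i + Y j i) ^ 2 := by positivity
  have eplus : ∑ i, ∑ j, (W j i + Y j i) ^ 2 =
      ∑ i, ∑ j, W j i ^ 2 + ∑ i, ∑ j, Y j i ^ 2 + 2 * ∑ i, ∑ j, W j i * Y j i := by
    simp only [add_sq, Finset.sum_add_distrib, Finset.mul_sum]
    ring
  have hminus : 0 ≤ ∑ i, ∑ j, (W j i - Y j i) ^ 2 := by positivity
  have eminus : ∑ i, ∑ j, (W j i - Y j i) ^ 2 =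
      ∑ i, ∑ j, W j i ^ 2 + ∑ i, ∑ j, Y j i ^ 2 - 2 * ∑ i, ∑ j, W j i * Y j i := by
    simp only [sub_sq, Finset.sum_add_distrib, Finset.sum_sub_distrib, Finset.mul_sum]
    ring
  rw [← abs_two, ← abs_mul]
  exact abs_le.2 ⟨by linarith, by linarith⟩

omit [DecidableEq ι] in
/-- Sub-multiplicativity of the Frobenius norm: `tr((SW)ᵀ(SW)) ≤ tr(SᵀS) · tr(WᵀW)`. [folklore] -/
theorem trace_transpose_mul_self_mul_le (S W : Matrix ι ι ℝ) :
    ((S * W)ᵀ * (S * W)).trace ≤ (Sᵀ * S).trace * (Wᵀ * W).trace := by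
  rw [trace_transpose_mul_self_eq_sum, trace_transpose_mul_self_eq_sum,
    trace_transpose_mul_self_eq_sum]
  -- `(SW)_{ji} = Σ_k S_{jk} W_{ki}`, Cauchy–Schwarz in `k`
  have hcs : ∀ i j, (S * W) j i ^ 2 ≤ (∑ k, S j k ^ 2) * (∑ k, W k i ^ 2) := by
    intro i j
    rw [Matrix.mul_apply]
    exact Finset.sum_mul_sq_le_sq_mul_sq Finset.univ (fun k ↦ S j k) (fun k ↦ W k i)
  calc ∑ i, ∑ j, (S * W) j i ^ 2 ≤ ∑ i, ∑ j, (∑ k, S j k ^ 2) * (∑ k, W k i ^ 2) :=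
        Finset.sum_le_sum fun i _ ↦ Finset.sum_le_sum fun j _ ↦ hcs i j
    _ = (∑ j, ∑ k, S j k ^ 2) * (∑ i, ∑ k, W k i ^ 2) := by
        rw [Finset.sum_mul_sum, Finset.sum_comm]
    _ = (∑ i, ∑ j, S j i ^ 2) * (∑ i, ∑ j, W j i ^ 2) := by
        congr 1
        exact Finset.sum_comm

/-! ### Uniqueness for the matrix Jacobi equation (energy method) -/

omit [DecidableEq ι] in
/-- The trace is continuous along a continuous curve of matrices within a set. [folklore] -/
theorem continuousOn_matrix_trace {f : ℝ → Matrix ι ι ℝ} {s : Set ℝ} (h : ContinuousOn f s) :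
    ContinuousOn (fun t ↦ (f t).trace) s :=
  (LinearMap.toContinuousLinearMap (Matrix.traceLinearMap ι ℝ ℝ)).continuous.comp_continuousOn h

/-- **Uniqueness for `W'' + ℛW = 0` (energy method).** If `W'' = −ℛW` on `(a, b)` with `ℛ`
continuous and `W(τ) = W'(τ) = 0` for some `τ ∈ (a, b)`, then `W ≡ 0` on `(a, b)`: the energy
`E = tr(WᵀW) + tr(W'ᵀW')` satisfies `|E'| ≤ K E` on compact subintervals (Cauchy–Schwarz for the
Frobenius pairing), so `E e^{∓K(t−τ)}` is monotone on either side of `τ` and vanishes (Grönwall).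
Used for `V = W'(τ) ≠ 0` in Brendle's Lemma 2.4 ("standard uniqueness results for ODE imply that `W`
vanishes identically"). [cite: Brendle2022, Lemma 2.4 (proof)] -/
theorem jacobi_eq_zero_of_eq_zero {W W' R : ℝ → Matrix ι ι ℝ} {a b τ : ℝ} (hτ : τ ∈ Ioo a b)
    (hW : ∀ t ∈ Ioo a b, HasDerivAt W (W' t) t)
    (hW' : ∀ t ∈ Ioo a b, HasDerivAt W' (-(R t * W t)) t)
    (hRc : ContinuousOn R (Ioo a b)) (hWτ : W τ = 0) (hW'τ : W' τ = 0) :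
    ∀ t ∈ Ioo a b, W t = 0 := by
  intro t₀ ht₀
  -- a compact interval `[c, d] ⊆ (a, b)` containing `τ` and `t₀`
  set c : ℝ := min τ t₀ with hc
  set d : ℝ := max τ t₀ with hd
  have hac : a < c := lt_min hτ.1 ht₀.1
  have hdb : d < b := max_lt hτ.2 ht₀.2
  have hsub : Icc c d ⊆ Ioo a b := fun t ht ↦ ⟨lt_of_lt_of_le hac ht.1, lt_of_le_of_lt ht.2 hdb⟩
  have hτcd : τ ∈ Icc c d := ⟨min_le_left _ _, le_max_left _ _⟩
  have ht₀cd : t₀ ∈ Icc c d := ⟨min_le_right _ _, le_max_right _ _⟩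
  -- the energy and its derivative
  set E : ℝ → ℝ := fun t ↦ ((W t)ᵀ * W t).trace + ((W' t)ᵀ * W' t).trace with hE
  set E' : ℝ → ℝ := fun t ↦ 2 * ((W t)ᵀ * W' t).trace - 2 * ((W' t)ᵀ * (R t * W t)).trace
    with hE'
  have hEd : ∀ t ∈ Ioo a b, HasDerivAt E (E' t) t := by
    intro t ht
    have hm1 : HasDerivAt (fun s ↦ (W s)ᵀ * W s) ((W' t)ᵀ * W t + (W t)ᵀ * W' t) t := by
      have h := (hasDerivAt_matrix_transpose (hW t ht)).mul (hW t ht)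
      exact h
    have hm2 : HasDerivAt (fun s ↦ (W' s)ᵀ * W' s)
        ((-(R t * W t))ᵀ * W' t + (W' t)ᵀ * (-(R t * W t))) t := by
      have h := (hasDerivAt_matrix_transpose (hW' t ht)).mul (hW' t ht)
      exact h
    have h1 := hasDerivAt_matrix_trace hm1
    have h2 := hasDerivAt_matrix_trace hm2
    have h := h1.add h2
    refine h.congr_deriv ?_
    have e1 : ((W' t)ᵀ * W t).trace = ((W t)ᵀ * W' t).trace := by
      rw [← Matrix.trace_transpose, Matrix.transpose_mul, Matrix.transpose_transpose]
    have e2 : ((R t * W t)ᵀ * W' t).trace = ((W' t)ᵀ * (R t * W t)).trace := by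
      rw [← Matrix.trace_transpose, Matrix.transpose_mul, Matrix.transpose_transpose]
    simp only [hE', Matrix.trace_add, Matrix.transpose_neg, Matrix.neg_mul, Matrix.mul_neg,
      Matrix.trace_neg, e1, e2]
    ring
  -- the Grönwall constant on `[c, d]`
  obtain ⟨ρ, hρ⟩ : ∃ ρ : ℝ, ∀ t ∈ Icc c d, ((R t)ᵀ * R t).trace ≤ ρ := by
    have hφ : Continuous fun M : Matrix ι ι ℝ ↦ (Mᵀ * M).trace :=
      (continuous_id.matrix_transpose.matrix_mul continuous_id).matrix_trace
    have hcont : ContinuousOn (fun t ↦ ((R t)ᵀ * R t).trace) (Icc c d) :=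
      hφ.comp_continuousOn (hRc.mono hsub)
    obtain ⟨ρ, hρ⟩ := (isCompact_Icc.bddAbove_image hcont)
    exact ⟨ρ, fun t ht ↦ hρ (mem_image_of_mem _ ht)⟩
  set K : ℝ := 2 + max ρ 1 with hK
  have hK0 : 0 ≤ K := by have := le_max_right ρ 1; rw [hK]; linarith
  have hE0 : ∀ t, 0 ≤ E t := fun t ↦
    add_nonneg (trace_transpose_mul_self_nonneg _) (trace_transpose_mul_self_nonneg _)
  have hbound : ∀ t ∈ Icc c d, |E' t| ≤ K * E t := by
    intro t ht
    have h1 := two_mul_abs_trace_transpose_mul_le (W t) (W' t)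
    have h2 := two_mul_abs_trace_transpose_mul_le (W' t) (R t * W t)
    have h3 := trace_transpose_mul_self_mul_le (R t) (W t)
    have h4 : ((R t * W t)ᵀ * (R t * W t)).trace ≤ max ρ 1 * ((W t)ᵀ * W t).trace :=
      h3.trans (mul_le_mul_of_nonneg_right ((hρ t ht).trans (le_max_left _ _))
        (trace_transpose_mul_self_nonneg _))
    have hW0 := trace_transpose_mul_self_nonneg (W t)
    have hW'0 := trace_transpose_mul_self_nonneg (W' t)
    have hm1 : 1 ≤ max ρ 1 := le_max_right _ _
    set α : ℝ := ((W t)ᵀ * W' t).trace with hα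
    set β : ℝ := ((W' t)ᵀ * (R t * W t)).trace with hβ
    have htri : |E' t| ≤ 2 * |α| + 2 * |β| := by
      simp only [hE']
      calc |2 * α - 2 * β| ≤ |2 * α| + |2 * β| := abs_sub _ _
        _ = 2 * |α| + 2 * |β| := by rw [abs_mul, abs_mul, abs_two]
    have hmax : ((W' t)ᵀ * W' t).trace ≤ max ρ 1 * ((W' t)ᵀ * W' t).trace :=
      le_mul_of_one_le_left hW'0 hm1
    calc |E' t| ≤ 2 * |α| + 2 * |β| := htri
      _ ≤ (((W t)ᵀ * W t).trace + ((W' t)ᵀ * W' t).trace) +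
          (((W' t)ᵀ * W' t).trace + max ρ 1 * ((W t)ᵀ * W t).trace) := by linarith
      _ ≤ K * E t := by
          simp only [hE, hK]
          nlinarith
  have hEτ : E τ = 0 := by simp [hE, hWτ, hW'τ]
  have hEc : ContinuousOn E (Icc c d) := fun t ht ↦
    (hEd t (hsub ht)).continuousAt.continuousWithinAt
  -- backward: `F = E e^{K(t-τ)}` is monotone on `[c, τ]`
  have hback : ∀ t ∈ Icc c τ, E t = 0 := by
    intro t ht
    have hsub' : Icc c τ ⊆ Icc c d := Icc_subset_Icc_right hτcd.2
    set F : ℝ → ℝ := fun s ↦ E s * Real.exp (K * (s - τ)) with hF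
    have hFd : ∀ s ∈ Ioo c τ, HasDerivAt F ((E' s + K * E s) * Real.exp (K * (s - τ))) s := by
      intro s hs
      have hs' : s ∈ Ioo a b := hsub (hsub' ⟨hs.1.le, hs.2.le⟩)
      have he : HasDerivAt (fun s ↦ Real.exp (K * (s - τ))) (Real.exp (K * (s - τ)) * K) s := by
        have : HasDerivAt (fun s ↦ K * (s - τ)) K s := by
          simpa using ((hasDerivAt_id s).sub_const τ).const_mul K
        exact (Real.hasDerivAt_exp _).comp s this |>.congr_deriv (by ring)
      have h := (hEd s hs').mul he
      refine h.congr_deriv ?_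
      ring
    have hmono : MonotoneOn F (Icc c τ) := by
      refine monotoneOn_of_deriv_nonneg (convex_Icc c τ) ?_ ?_ ?_
      · exact (hEc.mono hsub').mul ((Real.continuous_exp.comp
          (continuous_const.mul (continuous_id.sub continuous_const))).continuousOn)
      · rw [interior_Icc]
        exact fun s hs ↦ (hFd s hs).differentiableAt.differentiableWithinAt
      · rw [interior_Icc]
        intro s hs
        rw [(hFd s hs).deriv]
        refine mul_nonneg ?_ (Real.exp_pos _).le
        have hb := hbound s (hsub' ⟨hs.1.le, hs.2.le⟩)
        have := neg_abs_le (E' s)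
        linarith
    have hFt : F t ≤ F τ := hmono ht ⟨ht.1.trans ht.2, le_rfl⟩ ht.2
    have hFτ : F τ = 0 := by simp [hF, hEτ]
    have hFt0 : 0 ≤ F t := mul_nonneg (hE0 t) (Real.exp_pos _).le
    have hF0 : F t = 0 := le_antisymm (hFτ ▸ hFt) hFt0
    have hexp : Real.exp (K * (t - τ)) ≠ 0 := (Real.exp_pos _).ne'
    simpa [hF, hexp] using hF0
  -- forward: `G = E e^{-K(t-τ)}` is antitone on `[τ, d]`
  have hfwd : ∀ t ∈ Icc τ d, E t = 0 := by
    intro t ht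
    have hsub' : Icc τ d ⊆ Icc c d := Icc_subset_Icc_left hτcd.1
    set G : ℝ → ℝ := fun s ↦ E s * Real.exp (-K * (s - τ)) with hG
    have hGd : ∀ s ∈ Ioo τ d, HasDerivAt G ((E' s - K * E s) * Real.exp (-K * (s - τ))) s := by
      intro s hs
      have hs' : s ∈ Ioo a b := hsub (hsub' ⟨hs.1.le, hs.2.le⟩)
      have he : HasDerivAt (fun s ↦ Real.exp (-K * (s - τ)))
          (Real.exp (-K * (s - τ)) * (-K)) s := by
        have : HasDerivAt (fun s ↦ -K * (s - τ)) (-K) s := by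
          simpa using ((hasDerivAt_id s).sub_const τ).const_mul (-K)
        exact (Real.hasDerivAt_exp _).comp s this |>.congr_deriv (by ring)
      have h := (hEd s hs').mul he
      refine h.congr_deriv ?_
      ring
    have hanti : AntitoneOn G (Icc τ d) := by
      refine antitoneOn_of_deriv_nonpos (convex_Icc τ d) ?_ ?_ ?_
      · exact (hEc.mono hsub').mul ((Real.continuous_exp.comp
          (continuous_const.mul (continuous_id.sub continuous_const))).continuousOn)
      · rw [interior_Icc]
        exact fun s hs ↦ (hGd s hs).differentiableAt.differentiableWithinAt
      · rw [interior_Icc]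
        intro s hs
        rw [(hGd s hs).deriv]
        refine mul_nonpos_of_nonpos_of_nonneg ?_ (Real.exp_pos _).le
        have hb := hbound s (hsub' ⟨hs.1.le, hs.2.le⟩)
        have := le_abs_self (E' s)
        linarith
    have hGt : G t ≤ G τ := hanti ⟨le_rfl, ht.1.trans ht.2⟩ ht ht.1
    have hGτ : G τ = 0 := by simp [hG, hEτ]
    have hGt0 : 0 ≤ G t := mul_nonneg (hE0 t) (Real.exp_pos _).le
    have hG0 : G t = 0 := le_antisymm (hGτ ▸ hGt) hGt0
    have hexp : Real.exp (-K * (t - τ)) ≠ 0 := (Real.exp_pos _).ne'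
    simpa [hG, hexp] using hG0
  -- conclusion at `t₀`
  have hEt₀ : E t₀ = 0 := by
    rcases le_total t₀ τ with h | h
    · exact hback t₀ ⟨ht₀cd.1, h⟩
    · exact hfwd t₀ ⟨h, ht₀cd.2⟩
  have h1 : ((W t₀)ᵀ * W t₀).trace = 0 := by
    have := trace_transpose_mul_self_nonneg (W t₀)
    have := trace_transpose_mul_self_nonneg (W' t₀)
    simp only [hE] at hEt₀
    linarith
  exact (trace_transpose_mul_self_eq_zero_iff _).1 h1

/-! ### Smooth cut-offs -/

omit [Fintype ι] [DecidableEq ι] in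
/-- **Smooth decreasing cut-offs with controlled slope**: there is `M ≥ 0` such that for all `τ`
and `δ > 0` there is a smooth `ψ : ℝ → ℝ` with `ψ = 1` on `(-∞, τ − δ]`, `ψ = 0` on `[τ + δ, ∞)`,
`ψ' ≤ 0`, `|ψ'| ≤ M/δ`, and `ψ' = 0` off `(τ − δ, τ + δ)` (`ψ(t) = S((τ + δ − t)/(2δ))` with
Mathlib's `Real.smoothTransition`). [folklore] -/
theorem exists_smooth_cutoff_abs_deriv_le :
    ∃ M : ℝ, 0 ≤ M ∧ ∀ τ δ : ℝ, 0 < δ → ∃ ψ : ℝ → ℝ, ContDiff ℝ ∞ ψ ∧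
    (∀ t, t ≤ τ - δ → ψ t = 1) ∧ (∀ t, τ + δ ≤ t → ψ t = 0) ∧ (∀ t, deriv ψ t ≤ 0) ∧
    (∀ t, |deriv ψ t| ≤ M / δ) ∧ (∀ t, deriv ψ t ≠ 0 → τ - δ < t ∧ t < τ + δ) ∧
    (∀ t, 0 ≤ ψ t) ∧ (∀ t, ψ t ≤ 1) := by
  set S := Real.smoothTransition with hS
  have hSc : ContDiff ℝ ∞ S := Real.smoothTransition.contDiff
  have hSd : Differentiable ℝ S := hSc.differentiable (by simp)
  -- a bound for `|S'|` (`Literature.Analysis.Calculus.exists_bound_deriv_smoothTransition`)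
  obtain ⟨M, hM0, hMall⟩ := Literature.Analysis.Calculus.exists_bound_deriv_smoothTransition
  refine ⟨M, hM0, fun τ δ hδ ↦ ?_⟩
  have h2δ : 0 < 2 * δ := by linarith
  set ψ : ℝ → ℝ := fun t ↦ S ((τ + δ - t) / (2 * δ)) with hψ
  have haff : ∀ t, HasDerivAt (fun t ↦ (τ + δ - t) / (2 * δ)) (-1 / (2 * δ)) t := by
    intro t
    have h := ((hasDerivAt_id t).const_sub (τ + δ)).div_const (2 * δ)
    simpa using h
  have hψd : ∀ t, HasDerivAt ψ (deriv S ((τ + δ - t) / (2 * δ)) * (-1 / (2 * δ))) t := fun t ↦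
    ((hSd _).hasDerivAt).comp t (haff t)
  have hψ' : ∀ t, deriv ψ t = deriv S ((τ + δ - t) / (2 * δ)) * (-1 / (2 * δ)) := fun t ↦
    (hψd t).deriv
  refine ⟨ψ, ?_, ?_, ?_, ?_, ?_, ?_, ?_, ?_⟩
  · exact hSc.comp ((contDiff_const.sub contDiff_id).div_const _)
  · intro t ht
    simp only [hψ]
    apply Real.smoothTransition.one_of_one_le
    rw [le_div_iff₀ h2δ]; linarith
  · intro t ht
    simp only [hψ]
    apply Real.smoothTransition.zero_of_nonpos
    rw [div_nonpos_iff]; right; constructor <;> linarith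
  · intro t
    rw [hψ']
    have h1 : 0 ≤ deriv S ((τ + δ - t) / (2 * δ)) := Real.smoothTransition.monotone.deriv_nonneg
    have h2 : -1 / (2 * δ) ≤ 0 := by rw [div_nonpos_iff]; right; constructor <;> linarith
    exact mul_nonpos_of_nonneg_of_nonpos h1 h2
  · intro t
    rw [hψ', abs_mul]
    have h1 := hMall ((τ + δ - t) / (2 * δ))
    have h2 : |(-1 : ℝ) / (2 * δ)| = 1 / (2 * δ) := by
      rw [abs_div, abs_neg, abs_one, abs_of_pos h2δ]
    rw [h2]
    calc |deriv S ((τ + δ - t) / (2 * δ))| * (1 / (2 * δ)) ≤ M * (1 / (2 * δ)) := by gcongr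
      _ = M / δ * (1 / 2) := by field_simp
      _ ≤ M / δ := by
          have : 0 ≤ M / δ := div_nonneg hM0 hδ.le
          linarith
  · intro t ht
    rw [hψ'] at ht
    have h1 : deriv S ((τ + δ - t) / (2 * δ)) ≠ 0 := fun h ↦ ht (by rw [h, zero_mul])
    have h2 : (τ + δ - t) / (2 * δ) ∈ Ioo (0 : ℝ) 1 := by
      by_contra h2
      rcases le_or_gt ((τ + δ - t) / (2 * δ)) 0 with h3 | h3
      · exact h1 (Literature.Analysis.Calculus.deriv_smoothTransition_of_nonpos h3)
      · exact h1 (Literature.Analysis.Calculus.deriv_smoothTransition_of_one_le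
          (not_lt.1 fun h4 ↦ h2 ⟨h3, h4⟩))
    rw [mem_Ioo, lt_div_iff₀ h2δ, div_lt_iff₀ h2δ] at h2
    constructor <;> linarith [h2.1, h2.2]
  · exact fun t ↦ Real.smoothTransition.nonneg _
  · exact fun t ↦ Real.smoothTransition.le_one _

/-! ### Trace identities -/

omit [DecidableEq ι] in
/-- `tr(Xᵀ Y) = tr(Yᵀ X)`. [folklore] -/
theorem trace_transpose_mul_comm (X Y : Matrix ι ι ℝ) : (Xᵀ * Y).trace = (Yᵀ * X).trace := by
  rw [← Matrix.trace_transpose, Matrix.transpose_mul, Matrix.transpose_transpose]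

omit [DecidableEq ι] in
/-- `tr(Xᵀ R Y) = tr(Yᵀ R X)` for symmetric `R`. [folklore] -/
theorem trace_transpose_mul_mul_comm {R : Matrix ι ι ℝ} (hR : R.IsSymm) (X Y : Matrix ι ι ℝ) :
    (Xᵀ * (R * Y)).trace = (Yᵀ * (R * X)).trace := by
  rw [← Matrix.trace_transpose, Matrix.transpose_mul, Matrix.transpose_mul, hR.eq,
    Matrix.transpose_transpose, Matrix.mul_assoc]

/-! ### Continuity helpers -/

omit [DecidableEq ι] in
/-- `t ↦ tr(F(t)ᵀ G(t))` is continuous where `F, G` are. [folklore] -/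
theorem continuousOn_trace_transpose_mul {F G : ℝ → Matrix ι ι ℝ} {s : Set ℝ}
    (hF : ContinuousOn F s) (hG : ContinuousOn G s) :
    ContinuousOn (fun t ↦ ((F t)ᵀ * G t).trace) s := by
  have hFt : ContinuousOn (fun t ↦ (F t)ᵀ) s :=
    (LinearMap.toContinuousLinearMap
      (Matrix.transposeLinearEquiv ι ι ℝ ℝ).toLinearMap).continuous.comp_continuousOn hF
  have hm : ContinuousOn (fun t ↦ (F t)ᵀ * G t) s := hFt.mul hG
  exact (LinearMap.toContinuousLinearMap
    (Matrix.traceLinearMap ι ℝ ℝ)).continuous.comp_continuousOn hm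

omit [DecidableEq ι] in
/-- Entries of a differentiable matrix curve are differentiable, with the entries of the
derivative. [folklore] -/
theorem hasDerivAt_matrix_entry {A : ℝ → Matrix ι ι ℝ} {A' : Matrix ι ι ℝ} {t : ℝ}
    (h : HasDerivAt A A' t) (i j : ι) : HasDerivAt (fun s ↦ A s i j) (A' i j) t := by
  set L : Matrix ι ι ℝ →L[ℝ] ℝ :=
    LinearMap.toContinuousLinearMap (Matrix.entryLinearMap ℝ ℝ i j) with hL
  have h2 : HasDerivAt (fun s ↦ L (A s)) (L A') t := L.hasFDerivAt.comp_hasDerivAt t h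
  exact h2

omit [DecidableEq ι] in
/-- **The pointwise algebra of Brendle's test field.** For `Z = pW + ηY`, `Z' = qW + pW' + ηY'`
(think `p = ψ(t)`, `q = ψ'(t)`) and symmetric `ℛ`,
`tr(Z'ᵀZ') − tr(ZᵀℛZ) = q² tr(WᵀW) − 2ηq (tr(W'ᵀY) − tr(WᵀY')) + η² (tr(Y'ᵀY') − tr(YᵀℛY)) + Φ'`,
where `Φ'` is the expression which, along a Jacobi field `W` (`W'' = −ℛW`), is the derivative of
`Φ = p² tr(W'ᵀW) + 2ηp tr(W'ᵀY)`. [folklore] -/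
theorem secondVariation_integrand_identity {R W W' Y Y' : Matrix ι ι ℝ} (hR : R.IsSymm)
    (p q η : ℝ) :
    ((q • W + p • W' + η • Y')ᵀ * (q • W + p • W' + η • Y')).trace
        - ((p • W + η • Y)ᵀ * (R * (p • W + η • Y))).trace
      = q ^ 2 * (Wᵀ * W).trace - 2 * η * q * ((W'ᵀ * Y).trace - (Wᵀ * Y').trace)
        + η ^ 2 * ((Y'ᵀ * Y').trace - (Yᵀ * (R * Y)).trace)
        + (2 * p * q * (W'ᵀ * W).trace + p ^ 2 * ((W'ᵀ * W').trace - (Wᵀ * (R * W)).trace)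
          + 2 * η * q * (W'ᵀ * Y).trace
          + 2 * η * p * ((W'ᵀ * Y').trace - (Wᵀ * (R * Y)).trace)) := by
  have e1 := trace_transpose_mul_comm W W'
  have e2 := trace_transpose_mul_comm Y' W
  have e3 := trace_transpose_mul_comm Y' W'
  have e4 := trace_transpose_mul_mul_comm hR Y W
  simp only [Matrix.transpose_add, Matrix.transpose_smul, Matrix.add_mul, Matrix.mul_add,
    Matrix.smul_mul, Matrix.mul_smul, Matrix.trace_add, Matrix.trace_smul, smul_eq_mul]
  linear_combination (p * q) * e1 + (η * q) * e2 + (η * p) * e3 - (η * p) * e4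

/-! ### The main theorem -/

set_option maxHeartbeats 800000 in
/-- **No conjugate points from the second-variation inequality (Brendle 2023, Lemma 2.4).** Let
`𝒜` be a smooth matrix curve solving the Jacobi equation `𝒜'' + ℛ𝒜 = 0` on `(a, b) ⊇ [0, r]`
(`ℛ` continuous and self-adjoint) with `𝒜(0) = I`, `𝒜'(0) = ℋ` self-adjoint, and suppose the
**second-variation inequality** holds: for every smooth matrix curve `Z` with `Z(r) = 0`,
`0 ≤ tr(Z(0)ᵀ ℋ Z(0)) + ∫₀ʳ (tr(Z'ᵀ Z') − tr(Zᵀ ℛ Z)) dt` (the frame form of Brendle's Lemma 2.3,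
the columns of `Z` being vector fields along `γ̄` vanishing at `t = r`). Then `det 𝒜(t) ≠ 0` for all
`t ∈ [0, r)`: a Jacobi field `W = 𝒜C₀` of the family vanishing at `τ ∈ (0, r)` would produce, by
cutting off at `τ` and perturbing towards `W'(τ) ≠ 0`, a curve `Z` violating the inequality (see
the module docstring). This is hypothesis `hunit` of `antitoneOn_det_div_pow_of_hessian`.
[cite: Brendle2022, Lemma 2.4] -/
theorem isUnit_det_jacobi_of_secondVariation {A A' R : ℝ → Matrix ι ι ℝ} {H : Matrix ι ι ℝ}
    {a b r : ℝ} (h0 : (0 : ℝ) ∈ Ioo a b) (hrb : r < b) (hr : 0 < r) (hAs : ContDiff ℝ ∞ A)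
    (hA : ∀ t ∈ Ioo a b, HasDerivAt A (A' t) t)
    (hA' : ∀ t ∈ Ioo a b, HasDerivAt A' (-(R t * A t)) t)
    (hR : ∀ t ∈ Ioo a b, (R t).IsSymm) (hRc : ContinuousOn R (Ioo a b))
    (hA0 : A 0 = 1) (hA'0 : A' 0 = H) (hH : H.IsSymm)
    (hSV : ∀ Z : ℝ → Matrix ι ι ℝ, ContDiff ℝ ∞ Z → Z r = 0 →
      0 ≤ ((Z 0)ᵀ * (H * Z 0)).trace + ∫ t in (0 : ℝ)..r,
        (((deriv Z t)ᵀ * deriv Z t).trace - ((Z t)ᵀ * (R t * Z t)).trace)) :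
    ∀ t ∈ Ico 0 r, IsUnit (A t).det := by
  intro τ hτ
  by_contra hunit
  have hdet : (A τ).det = 0 := by rwa [isUnit_iff_ne_zero, not_not] at hunit
  have hτ0 : τ ≠ 0 := by
    rintro rfl
    rw [hA0, Matrix.det_one] at hdet
    exact one_ne_zero hdet
  have hτpos : 0 < τ := lt_of_le_of_ne hτ.1 (Ne.symm hτ0)
  have hτab : τ ∈ Ioo a b := ⟨h0.1.trans hτpos, hτ.2.trans hrb⟩
  have hsub : Icc 0 r ⊆ Ioo a b := fun t ht ↦ ⟨lt_of_lt_of_le h0.1 ht.1, lt_of_le_of_lt ht.2 hrb⟩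
  have hsub' : uIcc 0 r ⊆ Ioo a b := by rw [uIcc_of_le hr.le]; exact hsub
  ------------------------------------------------------------------
  -- (1) the kernel vector and `C₀`
  ------------------------------------------------------------------
  obtain ⟨v, hv0, hv⟩ := Matrix.exists_mulVec_eq_zero_iff.2 hdet
  set C₀ : Matrix ι ι ℝ := Matrix.vecMulVec v v with hC₀
  have hAC₀ : A τ * C₀ = 0 := by
    ext i j
    have hk : (A τ *ᵥ v) i = ∑ k, A τ i k * v k := rfl
    simp only [hC₀, Matrix.mul_apply, Matrix.vecMulVec_apply, Matrix.zero_apply]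
    have e : ∑ k, A τ i k * (v k * v j) = (∑ k, A τ i k * v k) * v j := by
      rw [Finset.sum_mul]
      exact Finset.sum_congr rfl fun k _ ↦ by ring
    rw [e, ← hk, hv, Pi.zero_apply, zero_mul]
  have hC₀ne : C₀ ≠ 0 := by
    obtain ⟨i, hi⟩ := Function.ne_iff.1 hv0
    intro h
    have h1 : C₀ i i = 0 := by rw [h]; rfl
    simp only [hC₀, Matrix.vecMulVec_apply] at h1
    exact hi (mul_self_eq_zero.1 h1)
  ------------------------------------------------------------------
  -- (2) the Jacobi field `W = 𝒜 C₀`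
  ------------------------------------------------------------------
  set W : ℝ → Matrix ι ι ℝ := fun t ↦ A t * C₀ with hW
  set W' : ℝ → Matrix ι ι ℝ := fun t ↦ A' t * C₀ with hW'
  have hWd : ∀ t ∈ Ioo a b, HasDerivAt W (W' t) t := fun t ht ↦ (hA t ht).mul_const C₀
  have hW'd : ∀ t ∈ Ioo a b, HasDerivAt W' (-(R t * W t)) t := by
    intro t ht
    have h := (hA' t ht).mul_const C₀
    refine h.congr_deriv ?_
    simp only [hW]
    rw [Matrix.neg_mul, Matrix.mul_assoc]
  have hWs : ContDiff ℝ ∞ W := hAs.mul contDiff_const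
  have hW0 : W 0 = C₀ := by simp [hW, hA0]
  have hWτ : W τ = 0 := hAC₀
  have hW'0 : W' 0 = H * C₀ := by simp [hW', hA'0]
  have hWc : ContinuousOn W (Ioo a b) := fun t ht ↦ (hWd t ht).continuousAt.continuousWithinAt
  have hW'c : ContinuousOn W' (Ioo a b) := fun t ht ↦ (hW'd t ht).continuousAt.continuousWithinAt
  ------------------------------------------------------------------
  -- (3) `V = W'(τ) ≠ 0`
  ------------------------------------------------------------------
  set V : Matrix ι ι ℝ := W' τ with hV
  have hVne : V ≠ 0 := by
    intro hV0
    have hz := jacobi_eq_zero_of_eq_zero hτab hWd hW'd hRc hWτ hV0 0 h0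
    rw [hW0] at hz
    exact hC₀ne hz
  set θ₀ : ℝ := (Vᵀ * V).trace with hθ₀
  have hθ₀pos : 0 < θ₀ :=
    lt_of_le_of_ne (trace_transpose_mul_self_nonneg V)
      (fun h ↦ hVne ((trace_transpose_mul_self_eq_zero_iff V).1 h.symm))
  ------------------------------------------------------------------
  -- (4) a bump `Y = φ • V` at `τ`, supported in `(0, r)`
  ------------------------------------------------------------------
  set ρ₀ : ℝ := min τ (r - τ) / 2 with hρ₀
  have hminpos : 0 < min τ (r - τ) := lt_min hτpos (sub_pos.2 hτ.2)
  have hρ₀pos : 0 < ρ₀ := by positivity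
  have hρ₀τ : ρ₀ < τ := by
    have := min_le_left τ (r - τ); rw [hρ₀]; linarith
  have hρ₀r : τ + ρ₀ < r := by
    have := min_le_right τ (r - τ); rw [hρ₀]; linarith
  let B : ContDiffBump τ := ⟨ρ₀ / 2, ρ₀, by positivity, by linarith⟩
  have hBrOut : B.rOut = ρ₀ := rfl
  obtain ⟨φ, hφ⟩ : ∃ φ : ℝ → ℝ, φ = B := ⟨_, rfl⟩
  have hφs : ContDiff ℝ ∞ φ := hφ ▸ B.contDiff
  have hφτ : φ τ = 1 := by
    rw [hφ]
    exact B.one_of_mem_closedBall (Metric.mem_closedBall_self (by positivity))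
  have hφ0 : ∀ t, ρ₀ ≤ |t - τ| → φ t = 0 := fun t ht ↦ by
    rw [hφ]
    exact B.zero_of_le_dist (by rwa [hBrOut, Real.dist_eq])
  have hφzero : φ 0 = 0 := hφ0 0 (by rw [zero_sub, abs_neg, abs_of_pos hτpos]; linarith)
  have hφr : φ r = 0 := hφ0 r (by rw [abs_of_pos (by linarith)]; linarith)
  have hφd : ∀ t, HasDerivAt φ (deriv φ t) t := fun t ↦
    ((hφs.differentiable (by simp)) t).hasDerivAt
  have hφ'c : Continuous (deriv φ) := hφs.continuous_deriv (by simp)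
  set Y : ℝ → Matrix ι ι ℝ := fun t ↦ φ t • V with hY
  set Y' : ℝ → Matrix ι ι ℝ := fun t ↦ deriv φ t • V with hY'
  have hYd : ∀ t, HasDerivAt Y (Y' t) t := fun t ↦ (hφd t).smul_const V
  have hYs : ContDiff ℝ ∞ Y := hφs.smul contDiff_const
  have hY0 : Y 0 = 0 := by simp [hY, hφzero]
  have hYr : Y r = 0 := by simp [hY, hφr]
  have hYτ : Y τ = V := by simp [hY, hφτ]
  have hYc : Continuous Y := hφs.continuous.smul continuous_const
  have hY'c : Continuous Y' := hφ'c.smul continuous_const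
  -- the index form of `Y` and its integrand
  set g : ℝ → ℝ := fun t ↦ ((Y' t)ᵀ * Y' t).trace - ((Y t)ᵀ * (R t * Y t)).trace with hg
  set IY : ℝ := ∫ t in (0 : ℝ)..r, g t with hIY
  have hgc : ContinuousOn g (Ioo a b) :=
    (continuousOn_trace_transpose_mul hY'c.continuousOn hY'c.continuousOn).sub
      (continuousOn_trace_transpose_mul hYc.continuousOn (hRc.mul hYc.continuousOn))
  have hg_int : IntervalIntegrable g volume 0 r := (hgc.mono hsub').intervalIntegrable
  ------------------------------------------------------------------
  -- (5) the quadratic vanishing of `tr(WᵀW)` at `τ` and the continuity of `k` at `τ`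
  ------------------------------------------------------------------
  -- a bound on the entries of `W'` on `[0, r]`
  obtain ⟨L, hL⟩ : ∃ L : ℝ, ∀ t ∈ Icc 0 r, ∀ i j, |W' t i j| ≤ L := by
    have hc : ContinuousOn (fun t ↦ ∑ i, ∑ j, |W' t i j|) (Icc 0 r) := by
      refine continuousOn_finsetSum _ fun i _ ↦ continuousOn_finsetSum _ fun j _ ↦ ?_
      have h1 : Continuous fun M : Matrix ι ι ℝ ↦ M i j :=
        (LinearMap.toContinuousLinearMap (Matrix.entryLinearMap ℝ ℝ i j)).continuous
      exact (continuous_abs.comp h1).comp_continuousOn (hW'c.mono hsub)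
    obtain ⟨L, hL⟩ := isCompact_Icc.exists_bound_of_continuousOn hc
    refine ⟨L, fun t ht i j ↦ ?_⟩
    have h := hL t ht
    rw [Real.norm_eq_abs, abs_of_nonneg (Finset.sum_nonneg fun i _ ↦
      Finset.sum_nonneg fun j _ ↦ abs_nonneg _)] at h
    exact le_trans (Finset.single_le_sum (f := fun j ↦ |W' t i j|) (fun j _ ↦ abs_nonneg _)
      (Finset.mem_univ j) |>.trans (Finset.single_le_sum (f := fun i ↦ ∑ j, |W' t i j|)
        (fun i _ ↦ Finset.sum_nonneg fun j _ ↦ abs_nonneg _) (Finset.mem_univ i))) h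
  have hτr : τ ∈ Icc 0 r := ⟨hτ.1, hτ.2.le⟩
  have hentry : ∀ t ∈ Icc 0 r, ∀ i j, |W t i j| ≤ L * |t - τ| := by
    intro t ht i j
    have hf : ∀ x ∈ Icc 0 r, HasDerivWithinAt (fun s ↦ W s i j) (W' x i j) (Icc 0 r) x :=
      fun x hx ↦ (hasDerivAt_matrix_entry (hWd x (hsub hx)) i j).hasDerivWithinAt
    have key := (convex_Icc 0 r).norm_image_sub_le_of_norm_hasDerivWithin_le hf
      (fun x hx ↦ by rw [Real.norm_eq_abs]; exact hL x hx i j) hτr ht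
    rw [Real.norm_eq_abs, Real.norm_eq_abs] at key
    have hWτij : W τ i j = 0 := by rw [hWτ]; rfl
    rwa [hWτij, sub_zero] at key
  have ha1 : ∀ t ∈ Icc 0 r,
      ((W t)ᵀ * W t).trace ≤ (Fintype.card ι) ^ 2 * L ^ 2 * (t - τ) ^ 2 := by
    intro t ht
    rw [trace_transpose_mul_self_eq_sum]
    have h1 : ∀ i j, W t j i ^ 2 ≤ L ^ 2 * (t - τ) ^ 2 := by
      intro i j
      have h := hentry t ht j i
      have h2 : |W t j i| ^ 2 ≤ (L * |t - τ|) ^ 2 := pow_le_pow_left₀ (abs_nonneg _) h 2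
      rw [sq_abs, mul_pow, sq_abs] at h2
      exact h2
    calc ∑ i, ∑ j, W t j i ^ 2 ≤ ∑ i : ι, ∑ j : ι, L ^ 2 * (t - τ) ^ 2 :=
          Finset.sum_le_sum fun i _ ↦ Finset.sum_le_sum fun j _ ↦ h1 i j
      _ = (Fintype.card ι) ^ 2 * L ^ 2 * (t - τ) ^ 2 := by
          simp only [Finset.sum_const, Finset.card_univ, nsmul_eq_mul]
          ring
  -- the function `k = tr(W'ᵀY) − tr(WᵀY')`, with `k(τ) = θ₀`
  set k : ℝ → ℝ := fun t ↦ ((W' t)ᵀ * Y t).trace - ((W t)ᵀ * Y' t).trace with hk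
  have hkτ : k τ = θ₀ := by
    simp only [hk, hθ₀, hYτ, hWτ, hV, Matrix.transpose_zero, Matrix.zero_mul, Matrix.trace_zero,
      sub_zero]
  have hkcont : ContinuousOn k (Ioo a b) :=
    (continuousOn_trace_transpose_mul hW'c hYc.continuousOn).sub
      (continuousOn_trace_transpose_mul hWc hY'c.continuousOn)
  have hkc : ContinuousAt k τ := hkcont.continuousAt (Ioo_mem_nhds hτab.1 hτab.2)
  ------------------------------------------------------------------
  -- (6) the choice of `η`, `ε`, `δ`
  ------------------------------------------------------------------
  set η : ℝ := -(min 1 (θ₀ / (|IY| + 1))) / 2 with hη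
  have hmin0 : 0 < min 1 (θ₀ / (|IY| + 1)) := lt_min one_pos (by positivity)
  have hηneg : η < 0 := by rw [hη]; linarith
  have hηabs : |η| = min 1 (θ₀ / (|IY| + 1)) / 2 := by
    rw [hη, abs_of_neg (by linarith), neg_div, neg_neg]
  have hηθ : 0 < -η * θ₀ := mul_pos (by linarith) hθ₀pos
  have hηIY : η ^ 2 * IY ≤ -η * θ₀ / 2 := by
    have h1 : η ^ 2 * IY ≤ η ^ 2 * |IY| :=
      mul_le_mul_of_nonneg_left (le_abs_self _) (sq_nonneg _)
    have h2 : |η| ≤ θ₀ / (|IY| + 1) / 2 := by rw [hηabs]; gcongr; exact min_le_right _ _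
    have h3 : |η| * |IY| ≤ θ₀ / 2 := by
      calc |η| * |IY| ≤ θ₀ / (|IY| + 1) / 2 * |IY| := by gcongr
        _ = θ₀ / 2 * (|IY| / (|IY| + 1)) := by ring
        _ ≤ θ₀ / 2 * 1 := by
            apply mul_le_mul_of_nonneg_left _ (by positivity)
            rw [div_le_one (by positivity)]; linarith [abs_nonneg IY]
        _ = θ₀ / 2 := mul_one _
    have h4 : η ^ 2 * |IY| = |η| * (|η| * |IY|) := by rw [← sq_abs]; ring
    have h5 : |η| * (|η| * |IY|) ≤ |η| * (θ₀ / 2) :=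
      mul_le_mul_of_nonneg_left h3 (abs_nonneg _)
    rw [abs_of_neg hηneg] at h5 h4
    linarith
  set ε : ℝ := θ₀ / 4 with hε
  have hεpos : 0 < ε := by positivity
  obtain ⟨δ₁, hδ₁pos, hδ₁⟩ : ∃ δ₁ > 0, ∀ t, |t - τ| < δ₁ → |k t - k τ| < ε := by
    obtain ⟨δ₁, hδ₁, h⟩ := Metric.continuousAt_iff.1 hkc ε hεpos
    exact ⟨δ₁, hδ₁, fun t ht ↦ by
      have := h (by rwa [Real.dist_eq])
      rwa [Real.dist_eq] at this⟩
  obtain ⟨M, hM0, hcut⟩ := exists_smooth_cutoff_abs_deriv_le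
  set K₂ : ℝ := M * ((Fintype.card ι) ^ 2 * L ^ 2) with hK₂
  have hK₂0 : 0 ≤ K₂ := by positivity
  set δ : ℝ := min (min (τ / 2) ((r - τ) / 2)) (min (δ₁ / 2) (-η * θ₀ / (4 * K₂ + 1))) with hδ
  have hδpos : 0 < δ := by
    simp only [hδ, lt_min_iff]
    exact ⟨⟨by linarith, by linarith [hτ.2]⟩, by linarith, by positivity⟩
  have hδτ : δ ≤ τ / 2 := (min_le_left _ _).trans (min_le_left _ _)
  have hδr : δ ≤ (r - τ) / 2 := (min_le_left _ _).trans (min_le_right _ _)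
  have hδδ₁ : δ < δ₁ :=
    lt_of_le_of_lt ((min_le_right _ _).trans (min_le_left _ _)) (by linarith)
  have hδK : K₂ * δ ≤ -η * θ₀ / 4 := by
    have h1 : δ ≤ -η * θ₀ / (4 * K₂ + 1) := (min_le_right _ _).trans (min_le_right _ _)
    have h2 : K₂ * δ ≤ K₂ * (-η * θ₀ / (4 * K₂ + 1)) := mul_le_mul_of_nonneg_left h1 hK₂0
    have h3 : K₂ * (-η * θ₀ / (4 * K₂ + 1)) ≤ -η * θ₀ / 4 := by
      rw [mul_div_assoc', div_le_div_iff₀ (by positivity) (by norm_num)]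
      nlinarith [hK₂0, hηθ]
    exact h2.trans h3
  have h0τδ : 0 ≤ τ - δ := by linarith
  have hτδr : τ + δ ≤ r := by linarith
  ------------------------------------------------------------------
  -- (7) the cut-off and the test curve `Z = ψ • W + η • Y`
  ------------------------------------------------------------------
  obtain ⟨ψ, hψs, hψ1, hψ0, hψ'le, hψ'abs, hψ'supp, -, -⟩ := hcut τ δ hδpos
  have hψd : ∀ t, HasDerivAt ψ (deriv ψ t) t := fun t ↦
    ((hψs.differentiable (by simp)) t).hasDerivAt
  have hψ'c : Continuous (deriv ψ) := hψs.continuous_deriv (by simp)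
  have hψzero : ψ 0 = 1 := hψ1 0 h0τδ
  have hψr : ψ r = 0 := hψ0 r hτδr
  set Z : ℝ → Matrix ι ι ℝ := fun t ↦ ψ t • W t + η • Y t with hZ
  set Z' : ℝ → Matrix ι ι ℝ := fun t ↦ deriv ψ t • W t + ψ t • W' t + η • Y' t with hZ'
  have hZs : ContDiff ℝ ∞ Z := (hψs.smul hWs).add (hYs.const_smul η)
  have hZd : ∀ t ∈ Ioo a b, HasDerivAt Z (Z' t) t := by
    intro t ht
    have h1 := (hψd t).smul (hWd t ht)
    have h2 := (hYd t).const_smul η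
    have h := h1.add h2
    refine h.congr_deriv ?_
    simp only [hZ']
    abel
  have hZr : Z r = 0 := by simp [hZ, hψr, hYr]
  have hZ0 : Z 0 = C₀ := by simp [hZ, hψzero, hW0, hY0]
  have hderivZ : ∀ t ∈ Ioo a b, deriv Z t = Z' t := fun t ht ↦ (hZd t ht).deriv
  have hZc : ContinuousOn Z (Ioo a b) :=
    (hψs.continuous.continuousOn.fun_smul hWc).fun_add
      (continuousOn_const.fun_smul hYc.continuousOn)
  have hZ'c : ContinuousOn Z' (Ioo a b) :=
    ((hψ'c.continuousOn.fun_smul hWc).fun_add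
      (hψs.continuous.continuousOn.fun_smul hW'c)).fun_add
      (continuousOn_const.fun_smul hY'c.continuousOn)
  -- the second-variation inequality for `Z`
  set I : ℝ → ℝ := fun t ↦ ((Z' t)ᵀ * Z' t).trace - ((Z t)ᵀ * (R t * Z t)).trace with hI
  have hIc : ContinuousOn I (Ioo a b) :=
    (continuousOn_trace_transpose_mul hZ'c hZ'c).sub
      (continuousOn_trace_transpose_mul hZc (hRc.mul hZc))
  have hI_int : IntervalIntegrable I volume 0 r := (hIc.mono hsub').intervalIntegrable
  have hineq : 0 ≤ (C₀ᵀ * (H * C₀)).trace + ∫ t in (0 : ℝ)..r, I t := by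
    have h := hSV Z hZs hZr
    rw [hZ0] at h
    have hcongr : ∫ t in (0 : ℝ)..r,
        (((deriv Z t)ᵀ * deriv Z t).trace - ((Z t)ᵀ * (R t * Z t)).trace) =
        ∫ t in (0 : ℝ)..r, I t := by
      refine intervalIntegral.integral_congr fun t ht ↦ ?_
      simp only [hI, hderivZ t (hsub' ht)]
    rwa [hcongr] at h
  ------------------------------------------------------------------
  -- (8) the decomposition `I = P + Φ'`
  ------------------------------------------------------------------
  set P : ℝ → ℝ := fun t ↦ deriv ψ t ^ 2 * ((W t)ᵀ * W t).trace
    - 2 * η * deriv ψ t * k t + η ^ 2 * g t with hP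
  set Φ : ℝ → ℝ := fun t ↦ ψ t ^ 2 * ((W' t)ᵀ * W t).trace
    + 2 * η * ψ t * ((W' t)ᵀ * Y t).trace with hΦ
  have hPc : ContinuousOn P (Ioo a b) :=
    (((hψ'c.continuousOn.pow 2).mul (continuousOn_trace_transpose_mul hWc hWc)).sub
      ((continuousOn_const.mul hψ'c.continuousOn).mul hkcont)).add
      (continuousOn_const.mul hgc)
  have hP_int : IntervalIntegrable P volume 0 r := (hPc.mono hsub').intervalIntegrable
  have hident : ∀ t ∈ Ioo a b, I t = P t +
      (2 * ψ t * deriv ψ t * ((W' t)ᵀ * W t).trace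
        + ψ t ^ 2 * (((W' t)ᵀ * W' t).trace - ((W t)ᵀ * (R t * W t)).trace)
        + 2 * η * deriv ψ t * ((W' t)ᵀ * Y t).trace
        + 2 * η * ψ t * (((W' t)ᵀ * Y' t).trace - ((W t)ᵀ * (R t * Y t)).trace)) := by
    intro t ht
    have key := secondVariation_integrand_identity (W := W t) (W' := W' t) (Y := Y t)
      (Y' := Y' t) (hR t ht) (ψ t) (deriv ψ t) η
    simp only [hI, hP, hg, hk, hZ, hZ']
    linear_combination key
  have hΦd : ∀ t ∈ Ioo a b, HasDerivAt Φ (I t - P t) t := by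
    intro t ht
    have hm1 : HasDerivAt (fun s ↦ (W' s)ᵀ * W s)
        ((-(R t * W t))ᵀ * W t + (W' t)ᵀ * W' t) t := by
      have h := (hasDerivAt_matrix_transpose (hW'd t ht)).mul (hWd t ht)
      exact h
    have hm2 : HasDerivAt (fun s ↦ (W' s)ᵀ * Y s)
        ((-(R t * W t))ᵀ * Y t + (W' t)ᵀ * Y' t) t := by
      have h := (hasDerivAt_matrix_transpose (hW'd t ht)).mul (hYd t)
      exact h
    have h1 := hasDerivAt_matrix_trace hm1
    have h2 := hasDerivAt_matrix_trace hm2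
    have hψ2 : HasDerivAt (fun s ↦ ψ s ^ 2) (2 * ψ t * deriv ψ t) t := by
      have h := (hψd t).fun_pow 2
      refine h.congr_deriv ?_
      norm_num
    have hA1 : HasDerivAt (fun s ↦ ψ s ^ 2 * ((W' s)ᵀ * W s).trace)
        (2 * ψ t * deriv ψ t * ((W' t)ᵀ * W t).trace
          + ψ t ^ 2 * ((-(R t * W t))ᵀ * W t + (W' t)ᵀ * W' t).trace) t := by
      have h := hψ2.mul h1
      exact h
    have hB1 : HasDerivAt (fun s ↦ 2 * η * ψ s * ((W' s)ᵀ * Y s).trace)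
        (2 * η * deriv ψ t * ((W' t)ᵀ * Y t).trace
          + 2 * η * ψ t * ((-(R t * W t))ᵀ * Y t + (W' t)ᵀ * Y' t).trace) t := by
      have h := ((hψd t).const_mul (2 * η)).mul h2
      exact h
    have h := hA1.add hB1
    refine h.congr_deriv ?_
    rw [hident t ht]
    have e1 : ((R t * W t)ᵀ * W t).trace = ((W t)ᵀ * (R t * W t)).trace :=
      trace_transpose_mul_comm _ _
    have e2 : ((R t * W t)ᵀ * Y t).trace = ((W t)ᵀ * (R t * Y t)).trace := by
      rw [Matrix.transpose_mul, (hR t ht).eq, Matrix.mul_assoc]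
    simp only [Matrix.transpose_neg, Matrix.neg_mul, Matrix.trace_add, Matrix.trace_neg, e1, e2]
    ring
  have hΦr : Φ r = 0 := by simp [hΦ, hψr]
  have hΦ0 : Φ 0 = (C₀ᵀ * (H * C₀)).trace := by
    simp only [hΦ, hψzero, hW'0, hW0, hY0, Matrix.trace_zero, mul_zero, add_zero, one_pow,
      one_mul]
    rw [Matrix.transpose_mul, hH.eq, Matrix.mul_assoc]
  have hFTC : ∫ t in (0 : ℝ)..r, (I t - P t) = Φ r - Φ 0 :=
    intervalIntegral.integral_eq_sub_of_hasDerivAt (fun t ht ↦ hΦd t (hsub' ht))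
      (hI_int.sub hP_int)
  ------------------------------------------------------------------
  -- (9) the pointwise bound on `P` and the contradiction
  ------------------------------------------------------------------
  have hPle : ∀ t ∈ Icc 0 r,
      P t ≤ -(K₂ * δ + 3 / 2 * η * θ₀) * deriv ψ t + η ^ 2 * g t := by
    intro t ht
    have hq0 : deriv ψ t ≤ 0 := hψ'le t
    have hT1 : deriv ψ t ^ 2 * ((W t)ᵀ * W t).trace ≤ -(K₂ * δ) * deriv ψ t := by
      by_cases hq : deriv ψ t = 0
      · simp [hq]
      obtain ⟨h1, h2⟩ := hψ'supp t hq
      have hdist : |t - τ| < δ := abs_lt.2 ⟨by linarith, by linarith⟩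
      have htr : ((W t)ᵀ * W t).trace ≤ (Fintype.card ι) ^ 2 * L ^ 2 * δ ^ 2 := by
        refine (ha1 t ht).trans ?_
        have : (t - τ) ^ 2 ≤ δ ^ 2 := by
          rw [← sq_abs]; exact pow_le_pow_left₀ (abs_nonneg _) hdist.le 2
        exact mul_le_mul_of_nonneg_left this (by positivity)
      have hqabs : deriv ψ t ^ 2 ≤ (-deriv ψ t) * (M / δ) := by
        rw [← abs_of_nonpos hq0, ← sq_abs, sq]
        exact mul_le_mul_of_nonneg_left (hψ'abs t) (abs_nonneg _)
      have htr0 : 0 ≤ ((W t)ᵀ * W t).trace := trace_transpose_mul_self_nonneg _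
      have hδne : δ ≠ 0 := hδpos.ne'
      calc deriv ψ t ^ 2 * ((W t)ᵀ * W t).trace
          ≤ ((-deriv ψ t) * (M / δ)) * ((Fintype.card ι) ^ 2 * L ^ 2 * δ ^ 2) :=
            mul_le_mul hqabs htr htr0 (mul_nonneg (by linarith) (by positivity))
        _ = -(K₂ * δ) * deriv ψ t := by
            simp only [hK₂]
            field_simp
    have hT2 : -(2 * η * deriv ψ t * k t) ≤ -(3 / 2 * η * θ₀) * deriv ψ t := by
      by_cases hq : deriv ψ t = 0
      · simp [hq]
      obtain ⟨h1, h2⟩ := hψ'supp t hq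
      have hdist : |t - τ| < δ₁ :=
        lt_of_lt_of_le (abs_lt.2 ⟨by linarith, by linarith⟩) hδδ₁.le
      have hkt : 3 / 4 * θ₀ ≤ k t := by
        have h3 := hδ₁ t hdist
        rw [hkτ] at h3
        have h4 := (abs_lt.1 h3).1
        simp only [hε] at h4
        linarith
      have hc : -(2 * η * deriv ψ t) ≤ 0 := by
        have : 0 ≤ η * deriv ψ t := mul_nonneg_of_nonpos_of_nonpos hηneg.le hq0
        linarith
      calc -(2 * η * deriv ψ t * k t) = -(2 * η * deriv ψ t) * k t := by ring
        _ ≤ -(2 * η * deriv ψ t) * (3 / 4 * θ₀) := mul_le_mul_of_nonpos_left hkt hc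
        _ = -(3 / 2 * η * θ₀) * deriv ψ t := by ring
    simp only [hP]
    linarith [hT1, hT2]
  have hψ'int : IntervalIntegrable (deriv ψ) volume 0 r := hψ'c.intervalIntegrable 0 r
  have hB_int : IntervalIntegrable
      (fun t ↦ -(K₂ * δ + 3 / 2 * η * θ₀) * deriv ψ t + η ^ 2 * g t) volume 0 r :=
    (hψ'int.const_mul _).add (hg_int.const_mul _)
  have hψint : ∫ t in (0 : ℝ)..r, deriv ψ t = -1 := by
    rw [intervalIntegral.integral_eq_sub_of_hasDerivAt (fun t _ ↦ hψd t) hψ'int, hψr, hψzero]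
    norm_num
  have hbound_int :
      ∫ t in (0 : ℝ)..r, (-(K₂ * δ + 3 / 2 * η * θ₀) * deriv ψ t + η ^ 2 * g t)
        = (K₂ * δ + 3 / 2 * η * θ₀) + η ^ 2 * IY := by
    rw [intervalIntegral.integral_add (hψ'int.const_mul _) (hg_int.const_mul _),
      intervalIntegral.integral_const_mul, intervalIntegral.integral_const_mul, hψint, hIY]
    ring
  have hPint_le : ∫ t in (0 : ℝ)..r, P t ≤ (K₂ * δ + 3 / 2 * η * θ₀) + η ^ 2 * IY := by
    have h := intervalIntegral.integral_mono_on hr.le hP_int hB_int hPle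
    rwa [hbound_int] at h
  have hI_split : ∫ t in (0 : ℝ)..r, I t
      = (∫ t in (0 : ℝ)..r, P t) + ∫ t in (0 : ℝ)..r, (I t - P t) := by
    rw [intervalIntegral.integral_sub hI_int hP_int]
    ring
  have hfinal : (C₀ᵀ * (H * C₀)).trace + ∫ t in (0 : ℝ)..r, I t < 0 := by
    rw [hI_split, hFTC, hΦr, hΦ0]
    nlinarith [hPint_le, hδK, hηIY, hηθ]
  exact absurd hineq (not_le.2 hfinal)

end ABPNoConjugate

end Literature.Geometry.Riemannian

end
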